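import Literature.MathematicalPhysics.QuantumFieldTheory.Balaban1983to89.B8Prop5ExistsZdLan
import Literature.MathematicalPhysics.QuantumFieldTheory.Balaban1983to89.B8Prop5LandauDataZdPer
import Literature.MathematicalPhysics.QuantumFieldTheory.Balaban1983to89.B8Prop5JoinSectELocalRDWPer
import Literature.MathematicalPhysics.QuantumFieldTheory.Balaban1983to89.B8LeafModelZd3SockPer
import Literature.MathematicalPhysics.QuantumFieldTheory.Balaban1983to89.B8SockHFPWindows
import Literature.MathematicalPhysics.QuantumFieldTheory.Balaban1983to89.Node00.CarriersB8SubBPCutP5Kappa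

/-!
# [B8] Proposition 5, EXISTENCE CLAUSE (1.107)–(1.108), AS THE KNIT'S CONJUNCT `B8.Prop5Exists B₀′ B₁ (zdLanPer L B₁ (ι j) (p j))` ON THE
`P`-PERIODIC MEMBERS — the slot's own second currency (B8-P5-NESTED-SERVER, existence half, FILE 3b)

Bałaban, *Comm. Math. Phys.* **99** (1985) 75–102 ([B8]; PDF page = printed page − 74): Prop. 5 (1.107)–(1.109) p. 94, (1.68)–(1.69) p. 88,
(1.73)–(1.74) pp. 88–89, p. 89, (1.86)–(1.88) p. 91, (1.92)–(1.106) pp. 91–94, (1.38) p. 82, (1.29) p. 81, (1.3)–(1.5) p. 77, p. 77 («Ω_j ⊂ T_η»),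
§3 p. 98; [4] = Bałaban, *Comm. Math. Phys.* **99** (1985) 389–434, Thm 3.1 p. 397, (3.24)–(3.25) p. 394; [3] = Bałaban, *Averaging operations…*,
Prop. 10 p. 50, (4) p. 18.

p. 94 [PDF 20]: «**Proposition 5.** There exist positive constants c₂, c₃, depending on d and L only, such that for an arbitrary configuration U₁
satisfying (1.69), and for the configuration u₁ determined by U₁ and satisfying (1.68), (1.73), (1.74), if α₀ + α₁ ≦ c₂, then there exists a
configuration u′ = e^{iλ} satisfying the equations (1.107) and the bounds |λ|, |Dλ|₍₋₁₎ < 8B′₀B₁(α₀ + α₁) (1.108).»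

WHY THIS FILE (lead g33's WAKE-B8P5NestedServerExist ADDENDUM 2026-08-28T18:25:26Z; dag-n05-c IR-N05-P5NS ADDENDUM pub-ymgap l.41942): after the
E-currency servers (`B8Prop5NestedServerPerBody` ∕ `B8Prop5NestedServerPer`), serve the slot's OWN `B8.Prop5Exists B₀′ B₁ fam` (`B8.lean` :214) on the
`P`-periodic sub-models `B8Prop5LandauDataZdPer.zdLanPer L B₁ i P` (:75; `hyp169_iff` :115 ∕ `solves_iff` :129 ∕ `lamNorm_eq` :141 — the fields ARE `zdLan`'s
at the underlying data, `Iff.rfl`) — the periodic twin of n05-c's `B8Prop5ExistsZdLan.prop5Exists_zdLan_of_lettersRD`, torus-native (NOT a transfer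
device), in the shape of p21's uniqueness twin `B8Prop5UniqueZdLanPer.prop5Unique_zdLanPer_of_lettersAtPerNested` (p658676).

WHAT THIS FILE PROVES (kernel, 0 sorry, theorems only)
* §1 ★★ `prop5Exists_body_zdLanPer_of_join` — the ∃λ-body at ONE periodic member and one `(α₀, α₁)`: the twin's proof token for token on FILE 3a's
  witness-form periodic JOIN `B8Prop5JoinSectELocalRDWPer.hFP_kLevel_of_sectE_local'_RD_w_per` (witnesses from (1.68)+(1.73)+(1.74) by
  `B8Prop5WitnessOfDatum.hwit_of_hyp169`, (1.29) by `restr129_of_hyp169`, the (1.69) dictionary of `B8Prop5ExistsZdLan` §2, the Landau condition of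
  record by `isLandau138W_gaugeFixed_of_multiplier`, (1.108) strict by `lamNorm_lt_of_pointwise`); the datum `(u₁, A)` is periodic by the carrier's law,
  `U₀` by hypothesis, and `λ` comes out periodic (`B8LeafModelZd3SockPer.isPeriodic_of_forall_shift_e`) — an element of `zdLanPer`'s `Lam`.
* §2 ★★★ `prop5Exists_zdLanPer_of_lettersAtPerNested` ⊢ `B8.Prop5Exists B₀′ B₁ (fun j => zdLanPer L B₁ (ι j) (p j))` for `ι : J → ZdLanIdx`,
  `p : J → ℕ` with the member laws (`Ω_{j+1} ⊂ Ω_j`, «Bʲ(y) ⊂ Ω_j»), the torus data (`Lᵏ ∣ p j`, `Λ_j` shift-invariant, `U₀` periodic — p21's U3′ binders `hU₀per hPdiv hΛ`),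
  ONE supplier of the [4] letters at every member (n05-c's RD list with (E1) ∕ (E2) ∕ (1.91) at PERIODIC arguments and the (P) laws `G′` periodic-valued,
  `Q′ᵀCQ′` ∕ `H′` periodicity-preserving) below `c_L`, `2 ≤ B₁` (p. 89), `3·(2dL²)·B_G·B_R ≤ B₀′∕2`; windows DISCHARGED from one guard by
  `B8SockHFPWindows.hfpWindows_of_guard` (dag-n19-b) exactly as in the twin; `c₂ = min(cP, c_L)`.
* §3 ★★★ `prop5Exists_zdLanPer_idxB8LanCκPer` — §2 on dag-n05's nested periodic print-class index `Node00.IdxB8LanCκPer θ P M₁ R` at `ι := toZdLanIdx`,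
  `p := P`, the member laws READ OFF THE INDEX (`IdxB8LanCκPer.laws`, `IdxB8SubDPer.dvd`, `IdxB8LanCκPer.periodic`); displayed: `Λ_j`
  shift-invariance and the letters.

HONEST SCOPE.  Compositions of landed theorems BY NAME; Proposition 5's contraction, Sect. E, [4] Thm 3.1, [3] Prop. 10 are NOT re-proved — the [4]
letters with their laws are displayed HYPOTHESES (none of them is served at nested `Ω_j` in lit-balaban today; pub-ymgap node N06's periodic
Green's-function line); a server does NOT discharge N05 (dag-n05-c's consumers bear on stmt-QuantumFields-27364); count-neutral; `T_η` read as
`P`-periodic data on `ηℤᵈ`; one finite `T⁴` programme at fixed `ε` — nothing continuum ∕ ℝ⁴ ∕ OS ∕ mass-gap ∕ Clay: the Yang–Mills mass gap is NOT proved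
here or by anything this file feeds.  No `sorry`, no `def`, no `instance`, no `notation`.
-/

noncomputable section

open NormedSpace
open scoped BigOperators
open Complex (I)

namespace Literature.MathematicalPhysics.QuantumFieldTheory.Balaban1983to89.B8Prop5ExistsZdLanPer

open B7Prop1Explicit B7Prop2Explicit B7Prop1Local B7Eq92Concrete
open B7Prop2Explicit (C0 c2')
open B7Prop10General (C6 C4G)
open B7Prop9Flat (C5')
open B7Eq78Linearization (conjR zdBlocking QprimeIter)
open B7Eq170Flat (cj)
open B7Eq167Flat (InLambda Cond166 Cond167)
open B8Ineq130 (tlo thi)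
open B8Ineq132 (covDerivFwd covDeriv InAk BondTouches norm_conjR)
open B8Eq119TwistedAxial (Restr129 bgT)
open B8Eq140Level (SideTouches sideTouches_of_bondTouches)
open B8Eq184Proof (gaugeExp cfgExp)
open B8Eq182Proof (gAd)
open B8Eq188Proof (frakF3)
open B8Eq138LandauZd (IsLandau138W covDivB covLap QT)
open B8Eq178Averages (Cond168 Cond169)
open B8Ineq125Concrete (C2p)
open B8Eq1117Concrete (XSpace)
open B8Prop5ContractionKLevel (Bd2 Mc Kc)
open B8LambdaSpaceKLevel (wt)
open B8Prop5SocketDatum (sideTouches_pair_of_mem sideTouches_of_tower_bond norm_covDivB_le)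
open B8SockHFPAssembly (isSelfAdjoint_covDivB)
open B8Thm4AtLandau138 (pdevOn_tower_lt_of_inAk)
open B8Prop5KLevelLetters (isLandau138W_gaugeFixed_of_multiplier)
open B8Prop5LandauDataZd (Cond7374 ZdLanIdx zdLan lamNorm_lt_of_pointwise)
open B8Prop5LandauDataZdPer (zdLanPer)
open B8Prop5WitnessOfDatum (hwit_of_hyp169 restr129_of_hyp169)
open B8Prop5ExistsZdLan (sideTouches_of_bondTouches_two inLambda_mono covDerivFwd_eq_zero_of hA_of_cond169 bd2_covDivB_of_cond169
  eta_norm_back_le_of_cond169)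
open B8Prop5JoinSectELocalRDWPer (hFP_kLevel_of_sectE_local'_RD_w_per)
open B8LeafModelZd3SockPer (isPeriodic_of_forall_shift_e)
open T4TermwiseTorus (IsPeriodic)

-- `Site` alone could resolve to the torus sites of `Setup.lean`; re-export the `ℤ^d` sites of `B7Prop1Explicit`.
export B7Prop1Explicit (Site)

variable {d : ℕ}

/-! ## §1 PROPOSITION 5's EXISTENCE BODY AT THE PERIODIC MEMBER, from the [4] letters through the witness-form periodic JOIN -/

section Body

variable {𝔸 : Type} [CStarAlgebra 𝔸] [Nontrivial 𝔸]

/-- **PROPOSITION 5, EXISTENCE CLAUSE (1.107)–(1.108), THE ∃λ-BODY AT THE `P`-PERIODIC MEMBER `zdLanPer L B₁ i P` AND ONE `(α₀, α₁)`** — the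
periodic twin of `B8Prop5ExistsZdLan.prop5Exists_body_zdLan_of_join` (print's `T_η`, p. 77 «Ω_j ⊂ T_η», read as `P`-periodic data on `ηℤᵈ`): the
SAME setting and binders, with (E1) `g_rightΩ` ∕ (E2) `c_range` at PERIODIC arguments only, the (P) laws `hGper` ∕ `hqcq_per` ∕ `hHper`, (1.91)
`hQH` at level-periodic families only, and the torus data (`Lʲ ∣ P`, `Λ_j + (P∕Lʲ)e_i = Λ_j`, `U₀` `P`-periodic); the datum `(u₁, A)` is periodic by
the carrier `zdLanPer`'s law and the parameter `λ` comes out PERIODIC (an element of `zdLanPer`'s `Lam`).  PROOF: the twin's, token for token, on the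
witness-form periodic JOIN `B8Prop5JoinSectELocalRDWPer.hFP_kLevel_of_sectE_local'_RD_w_per` (witnesses from (1.68)+(1.73)+(1.74) by
`B8Prop5WitnessOfDatum.hwit_of_hyp169`, (1.29) by `restr129_of_hyp169`, the (1.69) dictionary `hA_of_cond169` ∕ `bd2_covDivB_of_cond169` ∕
`eta_norm_back_le_of_cond169`, the Landau condition of record by `isLandau138W_gaugeFixed_of_multiplier`, (1.108) strict by `lamNorm_lt_of_pointwise`).
[cite: Balaban1985RegularSpaces, Prop. 5 (1.107)–(1.108) p.94, (1.68)–(1.69) p.88, (1.73)–(1.74) pp.88–89, p.89, (1.86)–(1.88) p.91, (1.92)–(1.103) pp.91–93, (1.38) p.82, (1.29) p.81, p.77 («Ω_j ⊂ T_η»), §3 p.98; Balaban1985BackgroundPropagators, Thm 3.1 p.397, (3.24)–(3.25) p.394; Balaban1985Averaging, Prop. 10 p.50] -/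
theorem prop5Exists_body_zdLanPer_of_join (hd2 : 2 ≤ d) {L : ℕ} (hL : 2 ≤ L) {B₁ B₀' : ℝ} (hB₁ : 0 < B₁)
    (i : ZdLanIdx d 𝔸) (P : ℕ) (hΩ : ∀ j, i.Ω (j + 1) ⊆ i.Ω j)
    (htower : ∀ j, j ≤ i.k → ∀ y ∈ i.Λ j, ∀ x, InBox (tlo L y j) (thi L y j) x → x ∈ i.Ω j)
    {α₀ α₁ : ℝ} (hα₀ : 0 < α₀) (hα₁ : 0 < α₁)
    (p : (zdLanPer L B₁ i P).Cfg) (hp : (zdLanPer L B₁ i P).Hyp169 α₀ α₁ p)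
    -- letters of [4] at `(k, U₀)`, `Eb j := {b | SideTouches (Ω j) b}`; (E1) ∕ (E2) AT PERIODIC ARGUMENTS, (P) laws
    (g Δ : (Site d → 𝔸) →ₗ[ℂ] (Site d → 𝔸)) (q : (Site d → 𝔸) →ₗ[ℂ] (ℕ → Site d → 𝔸)) (qs : (ℕ → Site d → 𝔸) →ₗ[ℂ] (Site d → 𝔸))
    (Aw c : (ℕ → Site d → 𝔸) →ₗ[ℂ] (ℕ → Site d → 𝔸))
    (g_rightΩ : ∀ x, (∀ (z : Site d) (ι : Fin d), x (z + (P : ℤ) • e ι) = x z) → ∀ y ∈ i.Ω 0, (Δ (g x) + qs (Aw (q (g x)))) y = x y)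
    (c_range : ∀ f, (∀ (z : Site d) (ι : Fin d), f (z + (P : ℤ) • e ι) = f z) → q (g (g (qs (c (q f))))) = q f)
    (hGper : ∀ (f : Site d → 𝔸) (z : Site d) (ι : Fin d), g f (z + (P : ℤ) • e ι) = g f z)
    (hqcq_per : ∀ f : Site d → 𝔸, (∀ (z : Site d) (ι : Fin d), f (z + (P : ℤ) • e ι) = f z) →
      ∀ (z : Site d) (ι : Fin d), qs (c (q f)) (z + (P : ℤ) • e ι) = qs (c (q f)) z)
    -- the torus: every `Lʲ ∣ P`, shift-invariant `Λ_j`, periodic `U₀`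
    (hdiv : ∀ j, j ≤ i.k → ((L : ℤ) ^ j ∣ (P : ℤ)))
    (hΛ : ∀ j, j ≤ i.k → ∀ (y : Site d) (ι : Fin d), y + ((P : ℤ) / (L : ℤ) ^ j) • e ι ∈ i.Λ j ↔ y ∈ i.Λ j)
    (hU₀p : IsPeriodic P i.U₀)
    (hΔ : ∀ (f : Site d → 𝔸), ∀ x ∈ i.Ω 0, Δ f x = covLap i.η i.U₀ ((i.Ω 0).indicator f) x)
    (hqs : ∀ (μ : ℕ → Site d → 𝔸), ∀ x ∈ i.Ω 0, qs μ x = QT L i.k i.Λ i.U₀ μ x)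
    (hq : ∀ (f : Site d → 𝔸) (j : ℕ), j ≤ i.k → ∀ y ∈ i.Λ j, q f j y = QprimeIter (zdBlocking d L) (bgT L i.U₀) j f y)
    (H' : XSpace d i.k 𝔸 →ₗ[ℂ] (Site d → 𝔸)) {α₃ α₄ B₀'H B₂' : ℝ}
    (hα3 : C0 d * α₀ ≤ 1 / 3) (hα4 : 4 * α₀ ≤ c2' d L) (ha3 : 16 * d * L * B₁ * (α₀ + α₁) ≤ α₃) (hα₄ : 0 < α₄)
    (hα₄lt : α₄ < 8 * B₀' * B₁ * (α₀ + α₁)) (hc12 : B₁ * (α₀ + α₁) ≤ 1 / 12) (hBH : 0 < B₀'H) (hB₂ : 0 ≤ B₂')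
    (hH0 : ∀ (X : XSpace d i.k 𝔸) (x : Site d), ‖H' X x‖ ≤ B₀'H * ‖X‖)
    (hH1 : ∀ j, j ≤ i.k → ∀ (X : XSpace d i.k 𝔸), ∀ p ∈ {b : Site d × Fin d | SideTouches (i.Ω j) b.1 b.2},
      wt L i.η j * ‖covDerivFwd i.η i.U₀ p.2 (H' X) p.1‖ ≤ B₀'H * ‖X‖)
    (hH2 : ∀ X : XSpace d i.k 𝔸, Bd2 L i.η i.k i.Ω (covLap i.η i.U₀ (H' X)) (B₂' * ‖X‖))
    (hHsupp : ∀ (X : XSpace d i.k 𝔸) (x : Site d), x ∉ i.Ω 0 → H' X x = 0)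
    (hHequiv : ∀ X Y : XSpace d i.k 𝔸, (∀ p, Y p = -star (X p)) → ∀ x, H' Y x = -star (H' X x))
    (hHper : ∀ X : XSpace d i.k 𝔸, (∀ (b : Fin (i.k + 1) × Site d) (ι : Fin d), X (b.1, b.2 + ((P : ℤ) / (L : ℤ) ^ (b.1 : ℕ)) • e ι) = X b) →
      ∀ (z : Site d) (ι : Fin d), H' X (z + (P : ℤ) • e ι) = H' X z)
    (hQH : ∀ (Y : XSpace d i.k 𝔸), (∀ (b : Fin (i.k + 1) × Site d) (ι : Fin d), Y (b.1, b.2 + ((P : ℤ) / (L : ℤ) ^ (b.1 : ℕ)) • e ι) = Y b) →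
      ∀ (j : ℕ) (hj : j ≤ i.k) (y : Site d), y ∈ i.Λ j →
      QprimeIter (zdBlocking d L) (bgT L i.U₀) j (H' Y) y = Y (⟨j, Nat.lt_succ_of_le hj⟩, y))
    -- the JOIN's scalar windows, one-for-one
    (hα₃' : α₃ ≤ 1 / 200) (hs₁ : 200 * C6 d * (2 * α₄) ≤ 1) (hs₂ : 12000 * ((d : ℝ) + 1) * L * (2 * α₄) ≤ 1)
    (hs₃ : C4G d L * (α₀ + α₃ + 4 * (2 * α₄)) ≤ 1)
    (hs₄ : 1024 * ((d : ℝ) + 1) * ((d : ℝ) + 4) * L ^ 2 * α₀ ≤ 1) (hs₅ : 32 * ((d : ℝ) + 1) ^ 2 * C6 d * L ^ 2 * α₀ ≤ 1)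
    (hs₆ : 16 * d * C5' d * C6 d * (L : ℝ) ^ 2 * α₀ ≤ 1) (hs₇ : 8 * d * C6 d * L * α₀ ≤ 1)
    (hsm : α₃ + α₄ ≤ 1 / (4 * B₀'H * (2 * C2p d))) (hprod8 : 2 * C6 d * (α₃ + 4 * α₄) ≤ 1 / 8)
    {hE hE₂ lE lE₂ : ℝ} (hE_def : hE = B₀'H * (C2p d * (α₃ + α₄) * α₄)) (hE₂_def : hE₂ = B₂' * (C2p d * (α₃ + α₄) * α₄))
    (lE_def : lE = B₀'H * (4 * C2p d * (α₃ + 2 * α₄))) (lE₂_def : lE₂ = B₂' * (4 * C2p d * (α₃ + 2 * α₄)))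
    {BG BR : ℝ} (hBG : 0 ≤ BG) (hBR : 0 ≤ BR) (hcA' : L * (B₁ * (α₀ + α₁)) ≤ 1 / 13)
    (ha₁' : α₄ / 4 + hE ≤ 1 / 24) (hb₁' : α₄ / 4 + hE ≤ 1 / 140) (hθ : 10 * (α₄ / 4 + hE) * BR ≤ 1 / 2)
    (hG : ∀ (f : Site d → 𝔸) (m : ℝ), 0 ≤ m → Bd2 L i.η i.k i.Ω f m →
      (∀ x, ‖g f x‖ ≤ BG * m) ∧ ∀ j, j ≤ i.k → ∀ p ∈ {b : Site d × Fin d | SideTouches (i.Ω j) b.1 b.2},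
        wt L i.η j * ‖covDerivFwd i.η i.U₀ p.2 (g f) p.1‖ ≤ BG * m)
    (hGsupp : ∀ (f : Site d → 𝔸) (x : Site d), x ∉ i.Ω 0 → g f x = 0)
    (hGreal : ∀ f : Site d → 𝔸, (∀ j, j ≤ i.k → ∀ x ∈ i.Ω j, IsSelfAdjoint (f x)) → ∀ x, IsSelfAdjoint (g f x))
    (hRbd : ∀ (f : Site d → 𝔸) (m : ℝ), 0 ≤ m → Bd2 L i.η i.k i.Ω f m → Bd2 L i.η i.k i.Ω (f - g (qs (c (q (g f))))) (BR * m))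
    (hRreal : ∀ f : Site d → 𝔸, (∀ j, j ≤ i.k → ∀ x ∈ i.Ω j, IsSelfAdjoint (f x)) →
      ∀ j, j ≤ i.k → ∀ x ∈ i.Ω j, IsSelfAdjoint ((f - g (qs (c (q (g f))))) x))
    (h103 : BG * Mc d BR (α₄ / 4 + hE) (L * (B₁ * (α₀ + α₁))) hE₂ (2 * (d : ℝ) * (L : ℝ) ^ 2 * (B₁ * (α₀ + α₁))) ≤ α₄ / 4)
    (h106 : BG * Kc d BR (α₄ / 4 + hE) (L * (B₁ * (α₀ + α₁))) hE₂ (2 * (d : ℝ) * (L : ℝ) ^ 2 * (B₁ * (α₀ + α₁))) lE₂ (1 + lE) (1 + lE)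
      ≤ 1 / 2) :
    ∃ lam : (zdLanPer L B₁ i P).Lam, (zdLanPer L B₁ i P).Solves p lam ∧ (zdLanPer L B₁ i P).lamNorm lam < 8 * B₀' * B₁ * (α₀ + α₁) := by
  have hp' : (zdLan L B₁ i).Hyp169 α₀ α₁ p.1 := hp
  have hL1 : 1 ≤ L := le_trans (by norm_num) hL
  have hd1 : 1 ≤ d := le_trans (by norm_num) hd2
  have hLr : (1 : ℝ) ≤ L := by exact_mod_cast hL1
  have hη := i.hη
  have hU₀ := i.hU₀
  have hk := i.hk
  set s := α₀ + α₁ with hs_def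
  have hs0 : 0 < s := by rw [hs_def]; positivity
  have hcs0 : 0 ≤ B₁ * s := by positivity
  have hα₃ : 0 ≤ α₃ := le_trans (by positivity) ha3
  -- the datum: (1.33), (1.69), and the witnesses ∕ (1.29) from (1.68), (1.73), (1.74)
  have h33 : InAk L i.k i.η α₀ i.Ω i.U₀ := hp'.1
  have h69 : Cond169 L i.k i.η i.Ω i.U₀ p.1.1.2 (B₁ * (α₀ + α₁)) := hp'.2.1
  have hwit16 := hwit_of_hyp169 hL1 hB₁.le i (by positivity : 0 ≤ α₀ + α₁) hp'
  have hwit : ∀ j, j ≤ i.k → ∀ y ∈ i.Λ j, ∃ ut : Site d → 𝔸ˣ, (∀ x, ut x ∈ unitaryUnits 𝔸) ∧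
      InLambda L (clampCfg (tlo L y j) (thi L y j) i.U₀) ut j α₃ (((L : ℝ) ^ j)⁻¹) ∧
      ∀ x : Site d, tlo L y j ≤ x → x ≤ thi L y j → p.1.1.1 x = ut x := by
    intro j hj y hy
    obtain ⟨ut, hun, hW, hag⟩ := hwit16 j hj y hy
    exact ⟨ut, hun, inLambda_mono (by positivity) (by rw [hs_def] at ha3; linarith only [ha3]) hW, hag⟩
  have h129 : Restr129 L i.k i.Λ i.U₀ p.1.1.1 := restr129_of_hyp169 hL1 B₁ i hp'
  -- (1.33) on the towers; the bond classes `Eb j`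
  have h33t : ∀ j, j ≤ i.k → ∀ y ∈ i.Λ j, pdevOn (tlo L y j) (thi L y j) i.U₀ < α₀ * (((L : ℝ) ^ j)⁻¹) ^ 2 :=
    fun j hj y hy => pdevOn_tower_lt_of_inAk hL1 hα₀ h33 hj (htower j hj y hy)
  have hEbΩ : ∀ j, j ≤ i.k → ∀ x ∈ i.Ω j, ∀ μ : Fin d,
      (x, μ) ∈ {b : Site d × Fin d | SideTouches (i.Ω j) b.1 b.2} ∧ (x - e μ, μ) ∈ {b : Site d × Fin d | SideTouches (i.Ω j) b.1 b.2} :=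
    fun j _ x hx μ => sideTouches_pair_of_mem hd2 hx μ
  have hEbT : ∀ j, j ≤ i.k → ∀ y ∈ i.Λ j, ∀ (x : Site d) (κ : Fin d), InBox (tlo L y j) (thi L y j) x →
      InBox (tlo L y j) (thi L y j) (x + e κ) → (x, κ) ∈ {b : Site d × Fin d | SideTouches (i.Ω j) b.1 b.2} :=
    fun j hj y hy x κ hx _ => sideTouches_of_tower_bond hd2 htower hj hy x κ hx
  -- the source `A`: (1.69) ⇒ `hA`, `hDA`; Hermitian
  have hA := hA_of_cond169 hL1 hη hk hΩ hU₀ hcs0 h69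
  have hDA' := bd2_covDivB_of_cond169 (d := d) hL1 hη hk hΩ hU₀ hcs0 h69
  have hDA : Bd2 L i.η i.k i.Ω (fun y => covDivB i.η i.U₀ p.1.1.2 y) (2 * (d : ℝ) * (L : ℝ) ^ 2 * (B₁ * s)) := by
    intro j hj x hx
    have h := hDA' j hj x hx
    have h0 : 0 ≤ (d : ℝ) * (L : ℝ) ^ 2 * (B₁ * s) := by positivity
    exact h.trans (by linarith)
  have hAsa : ∀ x μ, IsSelfAdjoint (p.1.1.2 x μ) := p.1.2.2
  have hDAsa : ∀ j, j ≤ i.k → ∀ x ∈ i.Ω j, IsSelfAdjoint (covDivB i.η i.U₀ p.1.1.2 x) :=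
    fun _ _ x _ => isSelfAdjoint_covDivB hU₀ hAsa x
  -- the torus data per direction
  have hU₀per : ∀ (z : Site d) (ι : Fin d), i.U₀ (z + (P : ℤ) • e ι) = i.U₀ z := fun z ι => hU₀p z (e ι)
  have hAper : ∀ (z : Site d) (ι : Fin d), p.1.1.2 (z + (P : ℤ) • e ι) = p.1.1.2 z := fun z ι => p.2.2 z (e ι)
  have hu₁per : ∀ (z : Site d) (ι : Fin d), p.1.1.1 (z + (P : ℤ) • e ι) = p.1.1.1 z := fun z ι => p.2.1 z (e ι)
  -- THE JOIN (witness form, RD currency, ON THE TORUS)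
  obtain ⟨lam, hlper, hsa, hoff, h108, hmult, h129'⟩ :=
    hFP_kLevel_of_sectE_local'_RD_w_per (Ω := i.Ω) (Λs := i.Λ) (Eb := fun j => {b : Site d × Fin d | SideTouches (i.Ω j) b.1 b.2})
      (U₀ := i.U₀) (A := p.1.1.2) (u₁ := p.1.1.1) hL hη hU₀ (P : ℤ) hEbΩ hEbT g Δ q qs Aw c g_rightΩ c_range hdiv hΛ hU₀per hAper hu₁per hGper
      hqcq_per hΔ hqs hq H' hα₀ hα3 hα4 hα₃ hα₄ hBH hB₂ h33t hwit h129 hH0 hH1 hH2 hHsupp hHequiv hHper hQH hα₃' hs₁ hs₂ hs₃ hs₄ hs₅ hs₆ hs₇ hsm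
      hprod8 hE_def hE₂_def lE_def lE₂_def hBG hBR (by positivity) hcA' (by positivity) ha₁' hb₁' hθ hG hGsupp hGreal hRbd hRreal hDA hDAsa hA
      hAsa h103 h106
  -- the parameter as an element of the member's `Lam` (global bounds from (1.108) at level 0 and the support)
  have hμ0 : Fin d := ⟨0, by omega⟩
  have h0 : ∀ (y : Site d) (τ : Fin d), BondTouches (i.Ω 0) y τ →
      ‖lam y‖ ≤ α₄ ∧ i.η * ‖covDerivFwd i.η i.U₀ τ lam y‖ ≤ α₄ := fun y τ hb => by
    have h := h108 0 (Nat.zero_le _) (y, τ) (sideTouches_of_bondTouches_two hd2 hb)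
    simpa only [wt, pow_zero, one_mul] using h
  have hbd : ∃ C : ℝ, ∀ x, ‖lam x‖ ≤ C ∧ ∀ μ : Fin d, ‖covDerivFwd i.η i.U₀ μ lam x‖ ≤ C := by
    refine ⟨max α₄ (α₄ / i.η), fun x => ⟨?_, fun μ => ?_⟩⟩
    · by_cases hx : x ∈ i.Ω 0
      · exact ((h0 x hμ0 (Or.inl hx)).1).trans (le_max_left _ _)
      · rw [hoff x hx, norm_zero]; exact le_trans hα₄.le (le_max_left _ _)
    · by_cases hb : BondTouches (i.Ω 0) x μ
      · have h := (h0 x μ hb).2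
        have : ‖covDerivFwd i.η i.U₀ μ lam x‖ ≤ α₄ / i.η := by rw [le_div_iff₀ hη, mul_comm]; exact h
        exact this.trans (le_max_right _ _)
      · have hx : x ∉ i.Ω 0 := fun h => hb (Or.inl h)
        have hx' : x + e μ ∉ i.Ω 0 := fun h => hb (Or.inr h)
        rw [covDerivFwd_eq_zero_of i.U₀ μ (hoff x hx) (hoff _ hx'), norm_zero]
        exact le_trans hα₄.le (le_max_left _ _)
  let lamL : (zdLanPer L B₁ i P).Lam := ⟨⟨lam, hsa, hoff, hbd⟩, isPeriodic_of_forall_shift_e hlper⟩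
  -- the Landau condition OF RECORD for `(e^{iηA})^{(e^{iλ})⁻¹}` from the multiplier clause ((1.86)–(1.88) at the sites of `Ω₀`)
  have hC6 : (2 : ℝ) ≤ C6 d := by unfold C6; linarith [B7Prop10Flat.one_le_C5 (d := d)]
  have hα84 : α₄ ≤ 1 / 84 := by nlinarith
  have hl : ∀ x ∈ i.Ω 0, ‖lam x‖ ≤ 1 / 12 := fun x hx => ((h0 x hμ0 (Or.inl hx)).1).trans (hα84.trans (by norm_num))
  have hD : ∀ x ∈ i.Ω 0, ∀ μ, i.η * ‖covDerivFwd i.η i.U₀ μ lam x‖ ≤ 1 / 70 :=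
    fun x hx μ => ((h0 x μ (Or.inl hx)).2).trans (hα84.trans (by norm_num))
  have hback : ∀ x ∈ i.Ω 0, ∀ μ : Fin d, BondTouches (i.Ω 0) (x - e μ) μ := fun x hx μ => Or.inr (by rwa [sub_add_cancel])
  have ha : ∀ x ∈ i.Ω 0, ∀ μ, i.η * ‖covDeriv i.η i.U₀ μ lam x‖ ≤ 1 / 70 := fun x hx μ => by
    rw [B8Eq151V2Divergence.norm_covDeriv_eq (unitaryUnits_le_U1 (hU₀ _ _)) lam]
    exact ((h0 _ μ (hback x hx μ)).2).trans (hα84.trans (by norm_num))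
  have hY : ∀ x ∈ i.Ω 0, ∀ μ, i.η * ‖conjR (i.U₀ (x - e μ) μ)⁻¹ (p.1.1.2 (x - e μ) μ)‖ ≤ 1 / 12 :=
    fun x hx μ => (eta_norm_back_le_of_cond169 hk hη hU₀ h69 x hx μ).trans hc12
  have hLan : IsLandau138W L i.k i.η (i.Ω 0) i.Λ i.U₀ (mgauge i.U₀ (gaugeExp lam)⁻¹ (cfgExp i.η p.1.1.2)) :=
    isLandau138W_gaugeFixed_of_multiplier hη L i.k (i.Ω 0) i.Λ i.U₀ p.1.1.2 hl hD ha hY hmult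
  -- (1.108), strict, by the norm dictionary
  have hnorm : (zdLan L B₁ i).lamNorm lamL.1 < 8 * B₀' * B₁ * (α₀ + α₁) := by
    refine lamNorm_lt_of_pointwise L B₁ i hL1 lamL.1 hα₄.le hα₄lt (fun j hj x hx => ?_) (fun j hj x μ hb => ?_)
    · have hjk : j ≤ i.k := hj.trans (Nat.sub_le _ _)
      exact (h108 j hjk (x, hμ0) (hEbΩ j hjk x hx hμ0).1).1
    · have hjk : j ≤ i.k := hj.trans (Nat.sub_le _ _)
      have h := (h108 j hjk (x, μ) (sideTouches_of_bondTouches_two hd2 hb)).2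
      simpa only [wt] using h
  exact ⟨lamL, ⟨hLan, h129'⟩, hnorm⟩

end Body

/-! ## §2 THE `∃ c₂` SENTENCE: `B8.Prop5Exists B₀′ B₁ (zdLanPer L B₁ (ι a) (per a))` over a law-cut periodic index, windows from ONE guard -/

section Sentence

open B8SockHFPWindows (hfpWindows_of_guard)

variable {𝔸 : Type} [CStarAlgebra 𝔸] [Nontrivial 𝔸]

/-- ★★★ **PROPOSITION 5, EXISTENCE CLAUSE, AS THE KNIT'S CONJUNCT `p5e` ON THE `P`-PERIODIC MEMBERS** —
`B8.Prop5Exists B₀′ B₁ (fun a => zdLanPer L B₁ (ι a) (per a))` for a family of members `ι : J → ZdLanIdx` with periods `per : J → ℕ` obeying the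
member laws (`Ω_{j+1} ⊂ Ω_j`, «Bʲ(y) ⊂ Ω_j», `d ≥ 2`, `L ≥ 2`) and the torus data (`Lʲ ∣ per a`, `Λ_j` shift-invariant, `U₀` periodic), from the [4]
letters in the RD currency AT EVERY MEMBER with (E1) ∕ (E2) ∕ (1.91) at PERIODIC arguments and the (P) laws (`G′` periodic-valued, `Q′ᵀCQ′` and `H′`
periodicity-preserving) — the periodic twin of `B8Prop5ExistsZdLan.prop5Exists_zdLan_of_lettersRD`, SAME constants: the JOIN's scalar windows
DISCHARGED from one guard by `B8SockHFPWindows.hfpWindows_of_guard` read at `B₀ := B₁∕(5dL)`, half the record's `B₀′` (so (1.108) is strict), class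
constant `α₃ := 40d·L·B₁(α₀+α₁)`; displayed constant conditions `2 ≤ B₁` (p. 89) and `3·(2dL²)·B_G·B_R ≤ B₀′∕2`; `c₂` depends on `d, L, B₁, B₀′, B₀′_H,
B₂′, B_G, B_R, c_L` only.  Proof: `prop5Exists_body_zdLanPer_of_join` fed positionally.
[cite: Balaban1985RegularSpaces, Prop. 5 (1.107)–(1.108) p.94 («There exist positive constants c₂, c₃, depending on d and L only»), p.89, (1.99)–(1.103) p.93, (1.106) p.94, p.77 («Ω_j ⊂ T_η»), §3 p.98; Balaban1985BackgroundPropagators, Thm 3.1 p.397] -/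
theorem prop5Exists_zdLanPer_of_lettersAtPerNested (hd2 : 2 ≤ d) {L : ℕ} (hL : 2 ≤ L) {B₁ B₀' B₀'H B₂' BG BR cL : ℝ}
    (hB₁ : 2 ≤ B₁) (hB₀' : 0 < B₀') (hBH : 0 < B₀'H) (hB₂ : 0 ≤ B₂') (hBG : 0 ≤ BG) (hBR : 0 ≤ BR) (hcL : 0 < cL)
    (hfree : 3 * (2 * (d : ℝ) * (L : ℝ) ^ 2) * BG * BR ≤ B₀' / 2)
    {J : Type} (ι : J → ZdLanIdx d 𝔸) (per : J → ℕ)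
    (hΩ : ∀ a : J, ∀ j, (ι a).Ω (j + 1) ⊆ (ι a).Ω j)
    (htower : ∀ a : J, ∀ j, j ≤ (ι a).k → ∀ y ∈ (ι a).Λ j, ∀ x, InBox (tlo L y j) (thi L y j) x → x ∈ (ι a).Ω j)
    -- the torus, member by member (§3 p. 98; [3] (4) p. 18): `Lᵏ ∣ p a`, every `Λ_j` invariant under the period shifts, the background `U₀` `p a`-periodic
    (hU₀per : ∀ a : J, IsPeriodic (per a) (ι a).U₀)
    (hPdiv : ∀ a : J, ((L : ℤ) ^ (ι a).k ∣ (per a : ℤ)))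
    (hΛ : ∀ a : J, ∀ j, j ≤ (ι a).k → ∀ (y : Site d) (i : Fin d), y + ((per a : ℤ) / (L : ℤ) ^ j) • e i ∈ (ι a).Λ j ↔ y ∈ (ι a).Λ j)
    -- the [4] letters at every member, RD currency, (E1) ∕ (E2) ∕ (1.91) AT PERIODIC ARGUMENTS and the (P) laws, below the threshold `cL`
    (SLet : ∀ a : J, ∀ α₀ : ℝ, 0 < α₀ → α₀ ≤ cL → InAk L (ι a).k (ι a).η α₀ (ι a).Ω (ι a).U₀ →
      ∃ (g Δ : (Site d → 𝔸) →ₗ[ℂ] (Site d → 𝔸)) (q : (Site d → 𝔸) →ₗ[ℂ] (ℕ → Site d → 𝔸)) (qs : (ℕ → Site d → 𝔸) →ₗ[ℂ] (Site d → 𝔸))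
        (Aw c : (ℕ → Site d → 𝔸) →ₗ[ℂ] (ℕ → Site d → 𝔸)) (H' : XSpace d (ι a).k 𝔸 →ₗ[ℂ] (Site d → 𝔸)),
        (∀ x, (∀ (z : Site d) (i : Fin d), x (z + (per a : ℤ) • e i) = x z) → ∀ y ∈ (ι a).Ω 0, (Δ (g x) + qs (Aw (q (g x)))) y = x y) ∧
        (∀ f, (∀ (z : Site d) (i : Fin d), f (z + (per a : ℤ) • e i) = f z) → q (g (g (qs (c (q f))))) = q f) ∧
        (∀ (f : Site d → 𝔸) (z : Site d) (i : Fin d), g f (z + (per a : ℤ) • e i) = g f z) ∧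
        (∀ f : Site d → 𝔸, (∀ (z : Site d) (i : Fin d), f (z + (per a : ℤ) • e i) = f z) →
          ∀ (z : Site d) (i : Fin d), qs (c (q f)) (z + (per a : ℤ) • e i) = qs (c (q f)) z) ∧
        (∀ (f : Site d → 𝔸), ∀ x ∈ (ι a).Ω 0, Δ f x = covLap (ι a).η (ι a).U₀ (((ι a).Ω 0).indicator f) x) ∧
        (∀ (μ : ℕ → Site d → 𝔸), ∀ x ∈ (ι a).Ω 0, qs μ x = QT L (ι a).k (ι a).Λ (ι a).U₀ μ x) ∧
        (∀ (f : Site d → 𝔸) (j : ℕ), j ≤ (ι a).k → ∀ y ∈ (ι a).Λ j, q f j y = QprimeIter (zdBlocking d L) (bgT L (ι a).U₀) j f y) ∧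
        (∀ (X : XSpace d (ι a).k 𝔸) (x : Site d), ‖H' X x‖ ≤ B₀'H * ‖X‖) ∧
        (∀ j, j ≤ (ι a).k → ∀ (X : XSpace d (ι a).k 𝔸), ∀ p ∈ {b : Site d × Fin d | SideTouches ((ι a).Ω j) b.1 b.2},
          wt L (ι a).η j * ‖covDerivFwd (ι a).η (ι a).U₀ p.2 (H' X) p.1‖ ≤ B₀'H * ‖X‖) ∧
        (∀ X : XSpace d (ι a).k 𝔸, Bd2 L (ι a).η (ι a).k (ι a).Ω (covLap (ι a).η (ι a).U₀ (H' X)) (B₂' * ‖X‖)) ∧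
        (∀ (X : XSpace d (ι a).k 𝔸) (x : Site d), x ∉ (ι a).Ω 0 → H' X x = 0) ∧
        (∀ X Y : XSpace d (ι a).k 𝔸, (∀ p, Y p = -star (X p)) → ∀ x, H' Y x = -star (H' X x)) ∧
        (∀ X : XSpace d (ι a).k 𝔸, (∀ (b : Fin ((ι a).k + 1) × Site d) (i : Fin d), X (b.1, b.2 + ((per a : ℤ) / (L : ℤ) ^ (b.1 : ℕ)) • e i) = X b) →
          ∀ (z : Site d) (i : Fin d), H' X (z + (per a : ℤ) • e i) = H' X z) ∧
        (∀ (Y : XSpace d (ι a).k 𝔸), (∀ (b : Fin ((ι a).k + 1) × Site d) (i : Fin d), Y (b.1, b.2 + ((per a : ℤ) / (L : ℤ) ^ (b.1 : ℕ)) • e i) = Y b) →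
          ∀ (j : ℕ) (hj : j ≤ (ι a).k) (y : Site d), y ∈ (ι a).Λ j →
          QprimeIter (zdBlocking d L) (bgT L (ι a).U₀) j (H' Y) y = Y (⟨j, Nat.lt_succ_of_le hj⟩, y)) ∧
        (∀ (f : Site d → 𝔸) (r : ℝ), 0 ≤ r → Bd2 L (ι a).η (ι a).k (ι a).Ω f r →
          (∀ x, ‖g f x‖ ≤ BG * r) ∧ ∀ j, j ≤ (ι a).k → ∀ p ∈ {b : Site d × Fin d | SideTouches ((ι a).Ω j) b.1 b.2},
            wt L (ι a).η j * ‖covDerivFwd (ι a).η (ι a).U₀ p.2 (g f) p.1‖ ≤ BG * r) ∧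
        (∀ (f : Site d → 𝔸) (x : Site d), x ∉ (ι a).Ω 0 → g f x = 0) ∧
        (∀ f : Site d → 𝔸, (∀ j, j ≤ (ι a).k → ∀ x ∈ (ι a).Ω j, IsSelfAdjoint (f x)) → ∀ x, IsSelfAdjoint (g f x)) ∧
        (∀ (f : Site d → 𝔸) (r : ℝ), 0 ≤ r → Bd2 L (ι a).η (ι a).k (ι a).Ω f r →
          Bd2 L (ι a).η (ι a).k (ι a).Ω (f - g (qs (c (q (g f))))) (BR * r)) ∧
        (∀ f : Site d → 𝔸, (∀ j, j ≤ (ι a).k → ∀ x ∈ (ι a).Ω j, IsSelfAdjoint (f x)) →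
          ∀ j, j ≤ (ι a).k → ∀ x ∈ (ι a).Ω j, IsSelfAdjoint ((f - g (qs (c (q (g f))))) x))) :
    B8.Prop5Exists B₀' B₁ (fun a : J => zdLanPer L B₁ (ι a) (per a)) := by
  have hL1 : 1 ≤ L := le_trans (by norm_num) hL
  have hd1 : 1 ≤ d := le_trans (by norm_num) hd2
  have hLr : (1 : ℝ) ≤ L := by exact_mod_cast hL1
  have hdr : (1 : ℝ) ≤ d := by exact_mod_cast hd1
  have hB₁0 : 0 < B₁ := by linarith
  -- the guard at `B₀ := B₁/(5dL)`, half the record's `B₀′`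
  have hB₀ : 0 < B₁ / (5 * (d : ℝ) * L) := by positivity
  have hB : 2 ≤ 5 * (d : ℝ) * L * (B₁ / (5 * (d : ℝ) * L)) := by
    have e : 5 * (d : ℝ) * L * (B₁ / (5 * (d : ℝ) * L)) = B₁ := by field_simp
    rw [e]; exact hB₁
  obtain ⟨cP, hcP, hw⟩ := hfpWindows_of_guard hd1 hL1 hB₀ (half_pos hB₀') hB hBH hB₂ hBG hBR one_pos hfree
  unfold B8.Prop5Exists
  refine ⟨min cP cL, lt_min hcP hcL, fun a α₀ α₁ hα₀ hα₁ hs p hp => ?_⟩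
  have hsP : α₀ + α₁ ≤ cP := hs.trans (min_le_left _ _)
  have hsL : α₀ ≤ cL := by linarith [hs.trans (min_le_right cP cL)]
  have hs0 : 0 < α₀ + α₁ := by positivity
  have hx0 : 0 < B₁ * (α₀ + α₁) := mul_pos hB₁0 hs0
  -- the letters at this member
  obtain ⟨g, Δ, q, qs, Aw, c, H', g_rightΩ, c_range, hGper, hqcq_per, hΔ, hqs, hq, hH0, hH1, hH2, hHsupp, hHequiv, hHper, hQH, hG, hGsupp,
    hGreal, hRbd, hRreal⟩ := SLet a α₀ hα₀ hsL hp.1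
  -- the windows, read at the scales of the body theorem
  have e_cs : B₁ * (α₀ + α₁) = 5 * (d : ℝ) * L * (B₁ / (5 * (d : ℝ) * L)) * (α₀ + α₁) := by field_simp
  have e_α₄ : 4 * B₀' * B₁ * (α₀ + α₁) = 8 * (B₀' / 2) * (5 * (d : ℝ) * L * (B₁ / (5 * (d : ℝ) * L))) * (α₀ + α₁) := by
    field_simp; ring
  obtain ⟨-, -, -, -, -, -, hα3, hα4, -, -, -, hα₃', hs₁, hs₂, hs₃, hs₄, hs₅, hs₆, hs₇, hsm, hprod8, hcB13, ha₁', hb₁', hθ, h103, h106⟩ :=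
    hw α₀ α₁ hα₀ hα₁ hsP (B₁ * (α₀ + α₁)) (4 * B₀' * B₁ * (α₀ + α₁)) (L * (B₁ * (α₀ + α₁)))
      (2 * (d : ℝ) * (L : ℝ) ^ 2 * (B₁ * (α₀ + α₁)))
      (B₀'H * (C2p d * (40 * d * (L * (B₁ * (α₀ + α₁))) + 4 * B₀' * B₁ * (α₀ + α₁)) * (4 * B₀' * B₁ * (α₀ + α₁))))
      (B₂' * (C2p d * (40 * d * (L * (B₁ * (α₀ + α₁))) + 4 * B₀' * B₁ * (α₀ + α₁)) * (4 * B₀' * B₁ * (α₀ + α₁))))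
      (B₀'H * (4 * C2p d * (40 * d * (L * (B₁ * (α₀ + α₁))) + 2 * (4 * B₀' * B₁ * (α₀ + α₁)))))
      (B₂' * (4 * C2p d * (40 * d * (L * (B₁ * (α₀ + α₁))) + 2 * (4 * B₀' * B₁ * (α₀ + α₁)))))
      e_cs e_α₄ rfl rfl rfl rfl rfl rfl
  -- the remaining scalar facts of the body theorem
  have ha3 : 16 * (d : ℝ) * L * B₁ * (α₀ + α₁) ≤ 40 * d * (L * (B₁ * (α₀ + α₁))) := by
    have h0 : 0 ≤ (d : ℝ) * (L * (B₁ * (α₀ + α₁))) := by positivity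
    have e : 40 * (d : ℝ) * (L * (B₁ * (α₀ + α₁))) = 16 * d * L * B₁ * (α₀ + α₁) + 24 * (d * (L * (B₁ * (α₀ + α₁)))) := by ring
    rw [e]; linarith
  have hα₄ : 0 < 4 * B₀' * B₁ * (α₀ + α₁) := by positivity
  have hα₄lt : 4 * B₀' * B₁ * (α₀ + α₁) < 8 * B₀' * B₁ * (α₀ + α₁) := by
    have : 0 < B₀' * B₁ * (α₀ + α₁) := by positivity
    linarith
  have hc12 : B₁ * (α₀ + α₁) ≤ 1 / 12 := by
    have h1 : B₁ * (α₀ + α₁) ≤ L * (B₁ * (α₀ + α₁)) := le_mul_of_one_le_left hx0.le hLr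
    linarith
  exact prop5Exists_body_zdLanPer_of_join hd2 hL hB₁0 (ι a) (per a) (hΩ a) (htower a) hα₀ hα₁ p hp g Δ q qs Aw c g_rightΩ c_range hGper
    hqcq_per (fun j hj => (pow_dvd_pow (L : ℤ) hj).trans (hPdiv a)) (hΛ a) (hU₀per a) hΔ hqs hq H' hα3 hα4 ha3 hα₄ hα₄lt hc12 hBH hB₂ hH0 hH1 hH2 hHsupp hHequiv hHper hQH hα₃' hs₁ hs₂ hs₃
    hs₄ hs₅ hs₆ hs₇ hsm hprod8 rfl rfl rfl rfl hBG hBR hcB13 ha₁' hb₁' hθ hG hGsupp hGreal hRbd hRreal h103 h106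

end Sentence

#print axioms prop5Exists_zdLanPer_of_lettersAtPerNested

/-! ## §3 The sentence on dag-n05's nested periodic print-class index `Node00.IdxB8LanCκPer θ P M₁ R` -/

section Nested

open Node00 (IdxB8LanCκPer Stage3Params)

/-- ★★★ **PROPOSITION 5, EXISTENCE CLAUSE — THE SLOT's OWN SECOND CURRENCY ON THE NESTED `P`-PERIODIC PRINT-CLASS INDEX**:
`B8.Prop5Exists B₀′ B₁ (fun a : Node00.IdxB8LanCκPer θ P M₁ R => B8Prop5LandauDataZdPer.zdLanPer θ.L B₁ a.toZdLanIdx P)` (lead g33 addendum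
2026-08-28T18:25:26Z ∕ dag-n05-c IR-N05-P5NS ADDENDUM; `B8.lean` :214; member dictionary `zdLanPer` :75 with `hyp169_iff` ∕ `solves_iff` ∕ `lamNorm_eq`; index
`toZdLanIdx` = n05-d p655608 §4) — `prop5Exists_zdLanPer_of_lettersAtPerNested` at `ι := toZdLanIdx`, `per := P`, with the member laws READ OFF THE INDEX
(`IdxB8LanCκPer.laws`: nesting and towers; `IdxB8SubDPer.dvd`: `Lᵏ ∣ P`; `IdxB8LanCκPer.periodic`: `U₀` periodic); DISPLAYED: `Λ_j` shift-invariance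
at every member, the [4] letters at every member (RD currency, (E1) ∕ (E2) ∕ (1.91) at periodic arguments, (P) laws) below `c_L`, `2 ≤ B₁`,
`3·(2dL²)·B_G·B_R ≤ B₀′∕2`.  Torus-native (NOT the banked `prop5Unique_per_of_zd` device); periodic twin of `B8Prop5ExistsZdLan.prop5Exists_zdLan_of_lettersRD`.
[cite: Balaban1985RegularSpaces, Prop. 5 (1.107)–(1.108) p.94, (1.3)–(1.5) p.77, p.77 («Ω_j ⊂ T_η»), p.89, §3 p.98; Balaban1985BackgroundPropagators, Thm 3.1 p.397] -/
theorem prop5Exists_zdLanPer_idxB8LanCκPer (θ : Stage3Params) {P M₁ R : ℕ} (hd2 : 2 ≤ θ.D) (hL : 2 ≤ θ.L) {B₁ B₀' B₀'H B₂' BG BR cL : ℝ}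
    (hB₁ : 2 ≤ B₁) (hB₀' : 0 < B₀') (hBH : 0 < B₀'H) (hB₂ : 0 ≤ B₂') (hBG : 0 ≤ BG) (hBR : 0 ≤ BR) (hcL : 0 < cL)
    (hfree : 3 * (2 * (θ.D : ℝ) * (θ.L : ℝ) ^ 2) * BG * BR ≤ B₀' / 2)
    -- the torus: `Λ_j` shift-invariant at every member (the other member laws — nesting, towers, `Lʲ ∣ P`, `U₀` periodic — are the index's)
    (hΛ : ∀ a : IdxB8LanCκPer θ P M₁ R, ∀ j, j ≤ a.toZdLanIdx.k → ∀ (y : Site θ.D) (i : Fin θ.D), y + ((P : ℤ) / (θ.L : ℤ) ^ j) • e i ∈ a.toZdLanIdx.Λ j ↔ y ∈ a.toZdLanIdx.Λ j)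
        -- the [4] letters at every member, RD currency, (E1) ∕ (E2) ∕ (1.91) AT PERIODIC ARGUMENTS and the (P) laws, below the threshold `cL`
    (SLet : ∀ a : IdxB8LanCκPer θ P M₁ R, ∀ α₀ : ℝ, 0 < α₀ → α₀ ≤ cL → InAk θ.L a.toZdLanIdx.k a.toZdLanIdx.η α₀ a.toZdLanIdx.Ω a.toZdLanIdx.U₀ →
      ∃ (g Δ : (Site θ.D → θ.𝔸) →ₗ[ℂ] (Site θ.D → θ.𝔸)) (q : (Site θ.D → θ.𝔸) →ₗ[ℂ] (ℕ → Site θ.D → θ.𝔸)) (qs : (ℕ → Site θ.D → θ.𝔸) →ₗ[ℂ] (Site θ.D → θ.𝔸))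
        (Aw c : (ℕ → Site θ.D → θ.𝔸) →ₗ[ℂ] (ℕ → Site θ.D → θ.𝔸)) (H' : XSpace θ.D a.toZdLanIdx.k θ.𝔸 →ₗ[ℂ] (Site θ.D → θ.𝔸)),
        (∀ x, (∀ (z : Site θ.D) (i : Fin θ.D), x (z + (P : ℤ) • e i) = x z) → ∀ y ∈ a.toZdLanIdx.Ω 0, (Δ (g x) + qs (Aw (q (g x)))) y = x y) ∧
        (∀ f, (∀ (z : Site θ.D) (i : Fin θ.D), f (z + (P : ℤ) • e i) = f z) → q (g (g (qs (c (q f))))) = q f) ∧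
        (∀ (f : Site θ.D → θ.𝔸) (z : Site θ.D) (i : Fin θ.D), g f (z + (P : ℤ) • e i) = g f z) ∧
        (∀ f : Site θ.D → θ.𝔸, (∀ (z : Site θ.D) (i : Fin θ.D), f (z + (P : ℤ) • e i) = f z) →
          ∀ (z : Site θ.D) (i : Fin θ.D), qs (c (q f)) (z + (P : ℤ) • e i) = qs (c (q f)) z) ∧
        (∀ (f : Site θ.D → θ.𝔸), ∀ x ∈ a.toZdLanIdx.Ω 0, Δ f x = covLap a.toZdLanIdx.η a.toZdLanIdx.U₀ ((a.toZdLanIdx.Ω 0).indicator f) x) ∧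
        (∀ (μ : ℕ → Site θ.D → θ.𝔸), ∀ x ∈ a.toZdLanIdx.Ω 0, qs μ x = QT θ.L a.toZdLanIdx.k a.toZdLanIdx.Λ a.toZdLanIdx.U₀ μ x) ∧
        (∀ (f : Site θ.D → θ.𝔸) (j : ℕ), j ≤ a.toZdLanIdx.k → ∀ y ∈ a.toZdLanIdx.Λ j, q f j y = QprimeIter (zdBlocking θ.D θ.L) (bgT θ.L a.toZdLanIdx.U₀) j f y) ∧
        (∀ (X : XSpace θ.D a.toZdLanIdx.k θ.𝔸) (x : Site θ.D), ‖H' X x‖ ≤ B₀'H * ‖X‖) ∧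
        (∀ j, j ≤ a.toZdLanIdx.k → ∀ (X : XSpace θ.D a.toZdLanIdx.k θ.𝔸), ∀ p ∈ {b : Site θ.D × Fin θ.D | SideTouches (a.toZdLanIdx.Ω j) b.1 b.2},
          wt θ.L a.toZdLanIdx.η j * ‖covDerivFwd a.toZdLanIdx.η a.toZdLanIdx.U₀ p.2 (H' X) p.1‖ ≤ B₀'H * ‖X‖) ∧
        (∀ X : XSpace θ.D a.toZdLanIdx.k θ.𝔸, Bd2 θ.L a.toZdLanIdx.η a.toZdLanIdx.k a.toZdLanIdx.Ω (covLap a.toZdLanIdx.η a.toZdLanIdx.U₀ (H' X)) (B₂' * ‖X‖)) ∧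
        (∀ (X : XSpace θ.D a.toZdLanIdx.k θ.𝔸) (x : Site θ.D), x ∉ a.toZdLanIdx.Ω 0 → H' X x = 0) ∧
        (∀ X Y : XSpace θ.D a.toZdLanIdx.k θ.𝔸, (∀ p, Y p = -star (X p)) → ∀ x, H' Y x = -star (H' X x)) ∧
        (∀ X : XSpace θ.D a.toZdLanIdx.k θ.𝔸, (∀ (b : Fin (a.toZdLanIdx.k + 1) × Site θ.D) (i : Fin θ.D), X (b.1, b.2 + ((P : ℤ) / (θ.L : ℤ) ^ (b.1 : ℕ)) • e i) = X b) →
          ∀ (z : Site θ.D) (i : Fin θ.D), H' X (z + (P : ℤ) • e i) = H' X z) ∧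
        (∀ (Y : XSpace θ.D a.toZdLanIdx.k θ.𝔸), (∀ (b : Fin (a.toZdLanIdx.k + 1) × Site θ.D) (i : Fin θ.D), Y (b.1, b.2 + ((P : ℤ) / (θ.L : ℤ) ^ (b.1 : ℕ)) • e i) = Y b) →
          ∀ (j : ℕ) (hj : j ≤ a.toZdLanIdx.k) (y : Site θ.D), y ∈ a.toZdLanIdx.Λ j →
          QprimeIter (zdBlocking θ.D θ.L) (bgT θ.L a.toZdLanIdx.U₀) j (H' Y) y = Y (⟨j, Nat.lt_succ_of_le hj⟩, y)) ∧
        (∀ (f : Site θ.D → θ.𝔸) (r : ℝ), 0 ≤ r → Bd2 θ.L a.toZdLanIdx.η a.toZdLanIdx.k a.toZdLanIdx.Ω f r →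
          (∀ x, ‖g f x‖ ≤ BG * r) ∧ ∀ j, j ≤ a.toZdLanIdx.k → ∀ p ∈ {b : Site θ.D × Fin θ.D | SideTouches (a.toZdLanIdx.Ω j) b.1 b.2},
            wt θ.L a.toZdLanIdx.η j * ‖covDerivFwd a.toZdLanIdx.η a.toZdLanIdx.U₀ p.2 (g f) p.1‖ ≤ BG * r) ∧
        (∀ (f : Site θ.D → θ.𝔸) (x : Site θ.D), x ∉ a.toZdLanIdx.Ω 0 → g f x = 0) ∧
        (∀ f : Site θ.D → θ.𝔸, (∀ j, j ≤ a.toZdLanIdx.k → ∀ x ∈ a.toZdLanIdx.Ω j, IsSelfAdjoint (f x)) → ∀ x, IsSelfAdjoint (g f x)) ∧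
        (∀ (f : Site θ.D → θ.𝔸) (r : ℝ), 0 ≤ r → Bd2 θ.L a.toZdLanIdx.η a.toZdLanIdx.k a.toZdLanIdx.Ω f r →
          Bd2 θ.L a.toZdLanIdx.η a.toZdLanIdx.k a.toZdLanIdx.Ω (f - g (qs (c (q (g f))))) (BR * r)) ∧
        (∀ f : Site θ.D → θ.𝔸, (∀ j, j ≤ a.toZdLanIdx.k → ∀ x ∈ a.toZdLanIdx.Ω j, IsSelfAdjoint (f x)) →
          ∀ j, j ≤ a.toZdLanIdx.k → ∀ x ∈ a.toZdLanIdx.Ω j, IsSelfAdjoint ((f - g (qs (c (q (g f))))) x))) :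
    B8.Prop5Exists B₀' B₁ (fun a : IdxB8LanCκPer θ P M₁ R => zdLanPer θ.L B₁ a.toZdLanIdx P) :=
  prop5Exists_zdLanPer_of_lettersAtPerNested (𝔸 := θ.𝔸) hd2 hL hB₁ hB₀' hBH hB₂ hBG hBR hcL hfree (fun a : IdxB8LanCκPer θ P M₁ R => a.toZdLanIdx)
    (fun _ => P) (fun a => a.laws.2.1) (fun a => a.laws.2.2.1) (fun a => a.periodic)
    (fun a => by exact_mod_cast a.mem.1.dvd) hΛ SLet

end Nested

#print axioms prop5Exists_zdLanPer_idxB8LanCκPer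
#print axioms prop5Exists_body_zdLanPer_of_join

end Literature.MathematicalPhysics.QuantumFieldTheory.Balaban1983to89.B8Prop5ExistsZdLanPer

end
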